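import Summits.ResolutionOfSingularities.ResolutionOfSingularities.Theorems.FrobeniusLadderFInjectiveMacaulayficationTauFloorP2d5CXChart
import Summits.ResolutionOfSingularities.ResolutionOfSingularities.Theorems.FrobeniusLadderFInjectiveMacaulayficationTauFloorP2d5CYChartAlgebra
import Summits.ResolutionOfSingularities.ResolutionOfSingularities.Theorems.FrobeniusLadderFInjectiveMacaulayficationTauFloorBXChartNotFull
import HarnessLib

/-!
# (O-1″-X) The prime `𝔭 = (x̄, z̄′)` of the `D(x̄²)` chart `C_X = k[x, y′, u′, t′, s′][z′]/(z′² + x²z′ + x²Σ′)` of `Bl_τ(P2d5C)` — the generic point of the exceptional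
# divisor on that chart: `𝔭 = ker κ`, `height 𝔭 = 1`, and ★★ `¬ FullCl 2 ((C_X)_𝔭)`; every prime of `C_X` containing `x̄` (= every prime over the vertex) is NON-FULL;
# blowupAlgebra form: every prime `Q` of `A₀[τ/x̄²]` with `𝔪_v ≤ Q ∩ A₀` is NON-FULL
# (crux `FInjectiveMacaulayfication` stmt-ResolutionOfSingularities-15315, chain w45a; (O-1″) «the whole closed fibre of the P2d5C τ-floor is non-FULL», chart `D(x̄²)`;
# pattern = this seat's p640726 `…TauFloorP2d5CYChartNotFull` one tower level down; seat res-L1-w45a-stub-1 g11)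

[OURS · L1 W4.5a] Support file (`--supports stmt-ResolutionOfSingularities-15315 --as helper`); replaces the role of NO printed item; NOT a statement of any
manuscript; def-free; UNCONDITIONAL. §1–§2 over ANY field `k`; §3–§4 assume `CharP k 2` (clause transport along generizations). AI-written (AI review is weaker than
expert review).

SETTING (from `…TauFloorP2d5CXChart`): `B₀ = k[x, y′, u′, t′, s′] = MvPolynomial (Fin 5) k`, `C_X = AdjoinRoot g₀`, `g₀ = Z² + (C(x²)Z + C(x²(y′³+u′³+t′³+s′³)))`;
`κ : C_X → B₀` the kill map (`x ↦ 0` on `B₀` — the substitution `TauFloorP2d5CYChartAlgebra.killY_X` of the variable `X 0` —, `z̄′ ↦ 0`), a hypothesis with its two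
defining values (`exists_killMap`).
* §1 `exists_killMap`, `natDegree_g₀_le`, ★ `ker_killMap_eq : ker κ = (x̄, z̄′)`, `under_kerKillMap = (x)`, ★ `height_kerKillMap = 1`, `ringKrullDim_localization_kerKillMap = 1`;
* §2 ★★ `not_fullCl_localization_kerKillMap` : `s = (x̄)` is a system of parameters of the 1-dimensional `(C_X)_𝔭` (`z̄′² = −x̄²(z̄′ + Σ′) ∈ (x̄)`), `z̄′² ∈ (x̄²) = (s)^{[2]}`
  but `z̄′ ∉ (x̄)(C_X)_𝔭` (one-ε target `Frac(B₀)[ε]`: `x ↦ 0`, `z̄′ ↦ ε`; `C_X ∖ 𝔭 ↦` units) — clause 3 of `FullCl 2` fails at `e = 1`;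
* §3 ★★ `not_fullCl_stalk_of_mem` / `not_fullCl_localization_of_mem` [`CharP k 2`]: every prime `P ∋ x̄` of `C_X` (then `z̄′ ∈ P` too) is NON-FULL;
* §4 ★★ `not_fullCl_localization_blowupAlgebra_over` [`CharP k 2`]: every prime `Q` of `blowupAlgebra τ (x̄²)` with `𝔪_v ≤ Q ∩ A₀` is NON-FULL (transport along
  `TauFloorP2d5CXChart.exists_chartEquiv`).
[cite: Matsumura1987, Thm. 9.3, Thm. 9.5, Thm. 13.5] [cite: Fedder1983, Prop. 1.7 (context)]
-/

-- single-problem summit: the doubled namespace component is forced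
set_option linter.dupNamespace false

noncomputable section

namespace Summit.ResolutionOfSingularities.ResolutionOfSingularities.Theorems.FInjectiveMacaulayfication.TauFloorP2d5CXChartNotFull

open MvPolynomial IsLocalization AlgebraicGeometry CategoryTheory Literature.AlgebraicGeometry.Resolution
open Summit.ResolutionOfSingularities.ResolutionOfSingularities.Theorems.FInjectiveMacaulayfication
open SliceableCentre TauFloorP2d5CXChart

variable (k : Type) [Field k]

/-! ## §1 The kill map `κ`, its kernel `𝔭 = (x̄, z̄′)`, height, local dimension -/

/-- `natDegree g₀ ≤ 2`. [plumbing] -/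
theorem natDegree_g₀_le (g₀ : Polynomial (MvPolynomial (Fin 5) k)) (hg₀ : g₀ = Polynomial.X ^ 2 + (Polynomial.C (X 0 ^ 2) * Polynomial.X + Polynomial.C (X 0 ^ 2 * (X 1 ^ 3 + X 2 ^ 3 + X 3 ^ 3 + X 4 ^ 3)))) :
    g₀.natDegree ≤ 2 := by
  rw [hg₀]
  refine (Polynomial.natDegree_add_le _ _).trans (max_le (Polynomial.natDegree_X_pow_le 2) ?_)
  refine (Polynomial.natDegree_add_le _ _).trans (max_le ((Polynomial.natDegree_C_mul_le _ _).trans (Polynomial.natDegree_X_le.trans one_le_two)) ?_)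
  rw [Polynomial.natDegree_C]; exact Nat.zero_le _

/-- ★ **THE KILL MAP `κ : C_X → B₀`** (`x ↦ 0` on `B₀`, `z̄′ ↦ 0`) exists: `g₀(0) = x²·Σ′ ↦ 0`. [folklore] -/
theorem exists_killMap (g₀ : Polynomial (MvPolynomial (Fin 5) k)) (hg₀ : g₀ = Polynomial.X ^ 2 + (Polynomial.C (X 0 ^ 2) * Polynomial.X + Polynomial.C (X 0 ^ 2 * (X 1 ^ 3 + X 2 ^ 3 + X 3 ^ 3 + X 4 ^ 3)))) :
    ∃ κ : AdjoinRoot g₀ →+* MvPolynomial (Fin 5) k, κ.comp (AdjoinRoot.of g₀) = (aeval (fun i : Fin 5 => if i = 0 then (0 : MvPolynomial (Fin 5) k) else X i)).toRingHom ∧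
      κ (AdjoinRoot.root g₀) = 0 := by
  have e1 : Polynomial.eval₂ (aeval (fun i : Fin 5 => if i = 0 then (0 : MvPolynomial (Fin 5) k) else X i)).toRingHom 0 g₀ = 0 := by
    rw [hg₀]
    simp [Polynomial.eval₂_add, Polynomial.eval₂_mul, Polynomial.eval₂_pow, Polynomial.eval₂_C, Polynomial.eval₂_X]
  exact ⟨AdjoinRoot.lift _ 0 e1, RingHom.ext fun b => by rw [RingHom.comp_apply, AdjoinRoot.lift_of e1], AdjoinRoot.lift_root e1⟩

/-- `κ` restricted to `B₀` is `x ↦ 0`. [plumbing] -/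
theorem killMap_of (g₀ : Polynomial (MvPolynomial (Fin 5) k)) (κ : AdjoinRoot g₀ →+* MvPolynomial (Fin 5) k)
    (hκ : κ.comp (AdjoinRoot.of g₀) = (aeval (fun i : Fin 5 => if i = 0 then (0 : MvPolynomial (Fin 5) k) else X i)).toRingHom ∧ κ (AdjoinRoot.root g₀) = 0)
    (b : MvPolynomial (Fin 5) k) : κ (AdjoinRoot.of g₀ b) = aeval (fun i : Fin 5 => if i = 0 then (0 : MvPolynomial (Fin 5) k) else X i) b := by
  have h := RingHom.congr_fun hκ.1 b
  simpa using h

/-- ★ **`ker κ = (x̄, z̄′)`** — by the normal form `e = a + b z̄′` (`a, b ∈ B₀`): `κ(e) = a(x ↦ 0)`. [folklore] -/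
theorem ker_killMap_eq (g₀ : Polynomial (MvPolynomial (Fin 5) k)) (hg₀ : g₀ = Polynomial.X ^ 2 + (Polynomial.C (X 0 ^ 2) * Polynomial.X + Polynomial.C (X 0 ^ 2 * (X 1 ^ 3 + X 2 ^ 3 + X 3 ^ 3 + X 4 ^ 3))))
    (κ : AdjoinRoot g₀ →+* MvPolynomial (Fin 5) k)
    (hκ : κ.comp (AdjoinRoot.of g₀) = (aeval (fun i : Fin 5 => if i = 0 then (0 : MvPolynomial (Fin 5) k) else X i)).toRingHom ∧ κ (AdjoinRoot.root g₀) = 0) :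
    RingHom.ker κ = Ideal.span {AdjoinRoot.of g₀ (X 0), AdjoinRoot.root g₀} := by
  have hxI : AdjoinRoot.of g₀ (X 0) ∈ Ideal.span {AdjoinRoot.of g₀ (X 0), AdjoinRoot.root g₀} := Ideal.subset_span (Set.mem_insert _ _)
  have hzI : AdjoinRoot.root g₀ ∈ Ideal.span {AdjoinRoot.of g₀ (X 0), AdjoinRoot.root g₀} := Ideal.subset_span (Set.mem_insert_of_mem _ rfl)
  apply le_antisymm
  · intro e he
    rw [RingHom.mem_ker] at he
    obtain ⟨a, b, rfl⟩ := TauFloorBXChartAlgebra.exists_nf_of_monic_two (monic_g₀ k g₀ hg₀) (natDegree_g₀_le k g₀ hg₀) e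
    have hκa : aeval (fun i : Fin 5 => if i = 0 then (0 : MvPolynomial (Fin 5) k) else X i) a = 0 := by
      simp only [map_add, map_mul, hκ.2, mul_zero, add_zero, killMap_of k g₀ κ hκ] at he
      exact he
    have ha : a ∈ Ideal.span ({X 0} : Set (MvPolynomial (Fin 5) k)) := by
      rw [← TauFloorP2d5CYChartAlgebra.ker_killY_eq]; exact hκa
    have ha' : AdjoinRoot.of g₀ a ∈ Ideal.span {AdjoinRoot.of g₀ (X 0), AdjoinRoot.root g₀} := by
      have h := Ideal.mem_map_of_mem (AdjoinRoot.of g₀) ha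
      rw [Ideal.map_span, Set.image_singleton] at h
      exact (Ideal.span_le.mpr (Set.singleton_subset_iff.mpr hxI)) h
    exact Ideal.add_mem _ ha' (Ideal.mul_mem_left _ _ hzI)
  · rw [Ideal.span_le]
    rintro r hr
    rw [SetLike.mem_coe, RingHom.mem_ker]
    rcases hr with rfl | rfl
    · rw [killMap_of k g₀ κ hκ, TauFloorP2d5CYChartAlgebra.killY_X]; simp
    · exact hκ.2

/-- `ker κ ∩ B₀ = (x)`. [plumbing] -/
theorem under_kerKillMap (g₀ : Polynomial (MvPolynomial (Fin 5) k)) (κ : AdjoinRoot g₀ →+* MvPolynomial (Fin 5) k)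
    (hκ : κ.comp (AdjoinRoot.of g₀) = (aeval (fun i : Fin 5 => if i = 0 then (0 : MvPolynomial (Fin 5) k) else X i)).toRingHom ∧ κ (AdjoinRoot.root g₀) = 0) :
    (RingHom.ker κ).under (MvPolynomial (Fin 5) k) = Ideal.span {X 0} := by
  rw [Ideal.under_def, AdjoinRoot.algebraMap_eq, RingHom.comap_ker, hκ.1]
  exact TauFloorP2d5CYChartAlgebra.ker_killY_eq k

/-- ★ **`height (ker κ) = 1`** (INCOMPARABILITY + GOING-DOWN for the free finite `B₀`-algebra `C_X`, over `height (x) = 1`). [cite: Matsumura1987, Thm. 9.3, 9.5, 13.5] -/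
theorem height_kerKillMap (g₀ : Polynomial (MvPolynomial (Fin 5) k)) (hg₀ : g₀ = Polynomial.X ^ 2 + (Polynomial.C (X 0 ^ 2) * Polynomial.X + Polynomial.C (X 0 ^ 2 * (X 1 ^ 3 + X 2 ^ 3 + X 3 ^ 3 + X 4 ^ 3))))
    (κ : AdjoinRoot g₀ →+* MvPolynomial (Fin 5) k)
    (hκ : κ.comp (AdjoinRoot.of g₀) = (aeval (fun i : Fin 5 => if i = 0 then (0 : MvPolynomial (Fin 5) k) else X i)).toRingHom ∧ κ (AdjoinRoot.root g₀) = 0) :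
    (RingHom.ker κ).height = 1 := by
  haveI : (RingHom.ker κ).IsPrime := RingHom.ker_isPrime κ
  obtain ⟨hfree, hfin⟩ := free_finite k g₀ hg₀
  haveI : Algebra.IsIntegral (MvPolynomial (Fin 5) k) (AdjoinRoot g₀) := Algebra.IsIntegral.of_finite _ _
  have hu := under_kerKillMap k g₀ κ hκ
  apply le_antisymm
  · have h := FlatIntegralCM.height_le_height_under_of_isIntegral (A := MvPolynomial (Fin 5) k) (RingHom.ker κ)
    rwa [hu, TauFloorP2d5CYChartAlgebra.height_span_X0] at h
  · haveI : (Ideal.span ({X 0} : Set (MvPolynomial (Fin 5) k))).IsPrime := TauFloorP2d5CYChartAlgebra.isPrime_span_X0 k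
    haveI : (RingHom.ker κ).LiesOver (Ideal.span ({X 0} : Set (MvPolynomial (Fin 5) k))) := ⟨hu.symm⟩
    have h := Ideal.height_eq_height_add_of_liesOver_of_hasGoingDown (Ideal.span ({X 0} : Set (MvPolynomial (Fin 5) k))) (RingHom.ker κ)
    rw [TauFloorP2d5CYChartAlgebra.height_span_X0] at h
    rw [h]
    exact le_self_add

/-- ★ **`dim (C_X)_𝔭 = 1`** at `𝔭 = ker κ = (x̄, z̄′)`. [folklore] -/
theorem ringKrullDim_localization_kerKillMap (g₀ : Polynomial (MvPolynomial (Fin 5) k)) (hg₀ : g₀ = Polynomial.X ^ 2 + (Polynomial.C (X 0 ^ 2) * Polynomial.X + Polynomial.C (X 0 ^ 2 * (X 1 ^ 3 + X 2 ^ 3 + X 3 ^ 3 + X 4 ^ 3))))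
    (κ : AdjoinRoot g₀ →+* MvPolynomial (Fin 5) k)
    (hκ : κ.comp (AdjoinRoot.of g₀) = (aeval (fun i : Fin 5 => if i = 0 then (0 : MvPolynomial (Fin 5) k) else X i)).toRingHom ∧ κ (AdjoinRoot.root g₀) = 0)
    (Q : Ideal (AdjoinRoot g₀)) [Q.IsPrime] (hQ : Q = RingHom.ker κ) : ringKrullDim (Localization.AtPrime Q) = (1 : ℕ) := by
  rw [IsLocalization.AtPrime.ringKrullDim_eq_height Q (Localization.AtPrime Q)]
  subst hQ
  rw [height_kerKillMap k g₀ hg₀ κ hκ]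
  rfl

/-! ## §2 ★★ The local ring `(C_X)_𝔭` is NOT FULL -/

set_option maxHeartbeats 800000 in
-- one `AdjoinRoot.lift` + one localization lift into `F[ε]` and several ideal-membership computations
/-- ★★ **`¬ FullCl 2 ((C_X)_𝔭)` AT `𝔭 = ker κ = (x̄, z̄′)`**: `dim = 1`, `s = (x̄)` is a system of parameters (`z̄′² = −x̄²(z̄′ + Σ′) ∈ (x̄)`), `z̄′² ∈ (x̄²)`, but
`z̄′ ∉ (x̄)(C_X)_𝔭` — witnessed by `(C_X)_𝔭 → F[ε]` for ANY field `F` receiving `B₀` injectively (`x ↦ 0`, `z̄′ ↦ ε ≠ 0`). Over ANY field `k`.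
[OURS · certificate; cite: Fedder1983, Prop. 1.7 (context)] -/
theorem not_fullCl_localization_kerKillMap_of_injective {F : Type} [Field F] (ι : MvPolynomial (Fin 5) k →+* F) (hι : Function.Injective ι)
    (g₀ : Polynomial (MvPolynomial (Fin 5) k)) (hg₀ : g₀ = Polynomial.X ^ 2 + (Polynomial.C (X 0 ^ 2) * Polynomial.X + Polynomial.C (X 0 ^ 2 * (X 1 ^ 3 + X 2 ^ 3 + X 3 ^ 3 + X 4 ^ 3))))
    (κ : AdjoinRoot g₀ →+* MvPolynomial (Fin 5) k)
    (hκ : κ.comp (AdjoinRoot.of g₀) = (aeval (fun i : Fin 5 => if i = 0 then (0 : MvPolynomial (Fin 5) k) else X i)).toRingHom ∧ κ (AdjoinRoot.root g₀) = 0)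
    (Q : Ideal (AdjoinRoot g₀)) [Q.IsPrime] (hQ : Q = RingHom.ker κ) : ¬ FullCl 2 (Localization.AtPrime Q) := by
  classical
  intro hfull
  set L := Localization.AtPrime Q with hL
  set alg : AdjoinRoot g₀ →+* L := algebraMap (AdjoinRoot g₀) L with halg
  have hQeq : Q = Ideal.span {AdjoinRoot.of g₀ (X 0), AdjoinRoot.root g₀} := by rw [hQ, ker_killMap_eq k g₀ hg₀ κ hκ]
  have hxQ : AdjoinRoot.of g₀ (X 0) ∈ Q := hQeq ▸ Ideal.subset_span (Set.mem_insert _ _)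
  -- (1) the dimension
  have hdim : ringKrullDim L = (1 : ℕ) := ringKrullDim_localization_kerKillMap k g₀ hg₀ κ hκ Q hQ
  -- (2) the system of parameters `s = (x̄)`
  let s : Fin 1 → L := ![alg (AdjoinRoot.of g₀ (X 0))]
  have hxs : alg (AdjoinRoot.of g₀ (X 0)) ∈ Ideal.span (Set.range s) := Ideal.subset_span ⟨0, rfl⟩
  have hz2 : alg (AdjoinRoot.root g₀) ^ 2 = -(alg (AdjoinRoot.of g₀ (X 0)) ^ 2 * alg (AdjoinRoot.root g₀) +
      alg (AdjoinRoot.of g₀ (X 0)) ^ 2 * (alg (AdjoinRoot.of g₀ (X 1)) ^ 3 + alg (AdjoinRoot.of g₀ (X 2)) ^ 3 + alg (AdjoinRoot.of g₀ (X 3)) ^ 3 + alg (AdjoinRoot.of g₀ (X 4)) ^ 3)) := by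
    have h := congrArg alg (root_rel k g₀ hg₀)
    simp only [map_add, map_mul, map_pow, map_zero] at h
    linear_combination h
  have hz2mem : alg (AdjoinRoot.root g₀) ^ 2 ∈ Ideal.span (Set.range s) := by
    rw [hz2]
    exact (Ideal.span (Set.range s)).neg_mem (Ideal.add_mem _ (Ideal.mul_mem_right _ _ (Ideal.pow_mem_of_mem _ hxs 2 two_pos))
      (Ideal.mul_mem_right _ _ (Ideal.pow_mem_of_mem _ hxs 2 two_pos)))
  have hmaxL : IsLocalRing.maximalIdeal L = Q.map alg := (Localization.AtPrime.map_eq_maximalIdeal (I := Q)).symm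
  have hgen : ∀ r ∈ ({AdjoinRoot.of g₀ (X 0), AdjoinRoot.root g₀} : Set (AdjoinRoot g₀)), alg r ∈ (Ideal.span (Set.range s)).radical := by
    intro r hr
    rcases hr with rfl | rfl
    · exact Ideal.le_radical hxs
    · exact ⟨2, hz2mem⟩
  have hle : Ideal.span (Set.range s) ≤ IsLocalRing.maximalIdeal L := by
    rw [Ideal.span_le, hmaxL]
    rintro _ ⟨j, rfl⟩
    fin_cases j
    exact Ideal.mem_map_of_mem alg hxQ
  have hrad_eq : (Ideal.span (Set.range s)).radical = IsLocalRing.maximalIdeal L := by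
    apply le_antisymm
    · exact (Ideal.radical_mono hle).trans_eq (IsLocalRing.maximalIdeal.isMaximal L).isPrime.radical
    · rw [hmaxL]
      refine Ideal.map_le_iff_le_comap.mpr fun q hq => ?_
      rw [hQeq] at hq
      refine (Ideal.span_le.mpr ?_) hq
      rintro r hr
      exact hgen r hr
  have hrad : (Ideal.span (Set.range s)).radical.IsMaximal := by
    rw [hrad_eq]; exact IsLocalRing.maximalIdeal.isMaximal L
  -- (3) clause 3 of `FullCl 2` at `y = z̄′`, `e = 1`: `z̄′² = x̄²·(−(z̄′ + Σ′))`
  obtain ⟨-, hclause⟩ := hfull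
  have hsq : alg (AdjoinRoot.root g₀) ^ 2 ∈ Ideal.span ((fun q : L => q ^ 2) '' (Ideal.span (Set.range s) : Set L)) := by
    have e : alg (AdjoinRoot.root g₀) ^ 2 = alg (AdjoinRoot.of g₀ (X 0)) ^ 2 *
        (-(alg (AdjoinRoot.root g₀) + (alg (AdjoinRoot.of g₀ (X 1)) ^ 3 + alg (AdjoinRoot.of g₀ (X 2)) ^ 3 + alg (AdjoinRoot.of g₀ (X 3)) ^ 3 + alg (AdjoinRoot.of g₀ (X 4)) ^ 3))) := by
      rw [hz2]; ring
    rw [e]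
    exact Ideal.mul_mem_right _ _ (Ideal.subset_span (Set.mem_image_of_mem _ hxs))
  have hF3 : alg (AdjoinRoot.root g₀) ∈ Ideal.span (Set.range s) :=
    (hclause 1 hdim s hrad).2 _ ⟨1, by simpa only [pow_one] using hsq⟩
  -- (4) `z̄′ ∉ (x̄)(C_X)_𝔭`: the one-ε target `F[ε]`
  let g : MvPolynomial (Fin 5) k →+* DualNumber F :=
    (TrivSqZeroExt.inlHom F F).comp (ι.comp (aeval (fun i : Fin 5 => if i = 0 then (0 : MvPolynomial (Fin 5) k) else X i)).toRingHom)
  have hgapply : ∀ b, g b = TrivSqZeroExt.inl (ι (aeval (fun i : Fin 5 => if i = 0 then (0 : MvPolynomial (Fin 5) k) else X i) b)) := fun b => rfl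
  have hgx : g (X 0) = 0 := by rw [hgapply, TauFloorP2d5CYChartAlgebra.killY_X]; simp
  have e1 : Polynomial.eval₂ g DualNumber.eps g₀ = 0 := by
    rw [hg₀]
    simp only [Polynomial.eval₂_add, Polynomial.eval₂_mul, Polynomial.eval₂_pow, Polynomial.eval₂_C, Polynomial.eval₂_X, map_mul, map_pow, hgx,
      DualNumber.eps_pow_two]
    ring
  let φ₁ : AdjoinRoot g₀ →+* DualNumber F := AdjoinRoot.lift g DualNumber.eps e1
  have hφof : ∀ b, φ₁ (AdjoinRoot.of g₀ b) = g b := fun b => AdjoinRoot.lift_of e1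
  have hφz : φ₁ (AdjoinRoot.root g₀) = DualNumber.eps := AdjoinRoot.lift_root e1
  -- `fst ∘ φ₁ = Frac ∘ κ`
  let π₁ : DualNumber F →+* F := (TrivSqZeroExt.fstHom F F F).toRingHom
  have hπ : ∀ q : DualNumber F, π₁ q = TrivSqZeroExt.fst q := fun q => rfl
  have hfst : π₁.comp φ₁ = ι.comp κ := by
    refine TauFloorF5YChartAlgebra.adjoinRoot_ringHom_ext (fun b => ?_) ?_
    · change π₁ (φ₁ (AdjoinRoot.of g₀ b)) = ι (κ (AdjoinRoot.of g₀ b))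
      rw [hφof, killMap_of k g₀ κ hκ, hgapply, hπ, TrivSqZeroExt.fst_inl]
    · change π₁ (φ₁ (AdjoinRoot.root g₀)) = ι (κ (AdjoinRoot.root g₀))
      rw [hφz, hκ.2, map_zero, hπ, DualNumber.fst_eps]
  have hfst' : ∀ e : AdjoinRoot g₀, TrivSqZeroExt.fst (φ₁ e) = ι (κ e) := fun e => by
    rw [← hπ]; exact RingHom.congr_fun hfst e
  have hunit : ∀ y : Q.primeCompl, IsUnit (φ₁ y) := by
    rintro ⟨y, hy⟩
    change IsUnit (φ₁ y)
    rw [TrivSqZeroExt.isUnit_iff_isUnit_fst, hfst', isUnit_iff_ne_zero]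
    intro hc
    apply hy
    have hc' : κ y = 0 := hι (by rw [map_zero]; exact hc)
    change y ∈ Q
    rw [hQ, RingHom.mem_ker]; exact hc'
  let ψ : L →+* DualNumber F := IsLocalization.lift (M := Q.primeCompl) (S := L) (P := DualNumber F) (g := φ₁) hunit
  have hψ : ∀ r : AdjoinRoot g₀, ψ (alg r) = φ₁ r := fun r => IsLocalization.lift_eq (M := Q.primeCompl) (S := L) (P := DualNumber F) hunit r
  -- `ψ` kills `(s) = (x̄)` …
  have hψs : ∀ q ∈ Ideal.span (Set.range s), ψ q = 0 := by
    intro q hq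
    have hmap : Ideal.span (Set.range s) ≤ RingHom.ker ψ := by
      rw [Ideal.span_le]
      rintro _ ⟨j, rfl⟩
      rw [SetLike.mem_coe, RingHom.mem_ker]
      fin_cases j
      change ψ (alg (AdjoinRoot.of g₀ (X 0))) = 0
      rw [hψ, hφof, hgx]
    exact hmap hq
  -- … but `z̄′ ↦ ε ≠ 0`
  have h0 := hψs _ hF3
  rw [hψ, hφz] at h0
  have h1 := congrArg (fun q : DualNumber F => TrivSqZeroExt.snd q) h0
  simp at h1

/-- ★★ **`¬ FullCl 2 ((C_X)_𝔭)` AT `𝔭 = ker κ = (x̄, z̄′)`** (target field `F = Frac B₀`). Over ANY field `k`. [OURS · certificate; cite: Fedder1983, Prop. 1.7 (context)] -/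
theorem not_fullCl_localization_kerKillMap (g₀ : Polynomial (MvPolynomial (Fin 5) k)) (hg₀ : g₀ = Polynomial.X ^ 2 + (Polynomial.C (X 0 ^ 2) * Polynomial.X + Polynomial.C (X 0 ^ 2 * (X 1 ^ 3 + X 2 ^ 3 + X 3 ^ 3 + X 4 ^ 3))))
    (κ : AdjoinRoot g₀ →+* MvPolynomial (Fin 5) k)
    (hκ : κ.comp (AdjoinRoot.of g₀) = (aeval (fun i : Fin 5 => if i = 0 then (0 : MvPolynomial (Fin 5) k) else X i)).toRingHom ∧ κ (AdjoinRoot.root g₀) = 0)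
    (Q : Ideal (AdjoinRoot g₀)) [Q.IsPrime] (hQ : Q = RingHom.ker κ) : ¬ FullCl 2 (Localization.AtPrime Q) :=
  not_fullCl_localization_kerKillMap_of_injective k (algebraMap (MvPolynomial (Fin 5) k) (FractionRing (MvPolynomial (Fin 5) k)))
    (IsFractionRing.injective (MvPolynomial (Fin 5) k) (FractionRing (MvPolynomial (Fin 5) k))) g₀ hg₀ κ hκ Q hQ

/-! ## §3 ★★ Every prime of `C_X` containing `x̄` is a NON-FULL point -/

/-- `x̄ ∈ P` forces `z̄′ ∈ P` (`z̄′² = −x̄²(z̄′ + Σ′)`). [plumbing] -/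
theorem root_mem_of_X0_mem (g₀ : Polynomial (MvPolynomial (Fin 5) k)) (hg₀ : g₀ = Polynomial.X ^ 2 + (Polynomial.C (X 0 ^ 2) * Polynomial.X + Polynomial.C (X 0 ^ 2 * (X 1 ^ 3 + X 2 ^ 3 + X 3 ^ 3 + X 4 ^ 3))))
    (P : Ideal (AdjoinRoot g₀)) [P.IsPrime] (hx : AdjoinRoot.of g₀ (X 0) ∈ P) : AdjoinRoot.root g₀ ∈ P := by
  refine ‹P.IsPrime›.mem_of_pow_mem 2 ?_
  have e : AdjoinRoot.root g₀ ^ 2 = AdjoinRoot.of g₀ (X 0) * -(AdjoinRoot.of g₀ (X 0) * AdjoinRoot.root g₀ +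
      AdjoinRoot.of g₀ (X 0) * (AdjoinRoot.of g₀ (X 1) ^ 3 + AdjoinRoot.of g₀ (X 2) ^ 3 + AdjoinRoot.of g₀ (X 3) ^ 3 + AdjoinRoot.of g₀ (X 4) ^ 3)) := by
    linear_combination root_rel k g₀ hg₀
  rw [e]
  exact Ideal.mul_mem_right _ _ hx

/-- ★★ **EVERY POINT `w ∈ V(x̄) ⊂ Spec C_X` (= the exceptional divisor of the chart `D(x̄²)`, 4-dimensional) IS A NON-FULL POINT** [`CharP k 2`]: FULL descends to
generizations (`ClauseLocalizes.fiClause_of_specializes`) and the generic point `𝔭` is not FULL (§2). [OURS · certificate; cite: Fedder1983, Prop. 1.7 (context)] -/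
theorem not_fullCl_stalk_of_mem [CharP k 2] (g₀ : Polynomial (MvPolynomial (Fin 5) k)) (hg₀ : g₀ = Polynomial.X ^ 2 + (Polynomial.C (X 0 ^ 2) * Polynomial.X + Polynomial.C (X 0 ^ 2 * (X 1 ^ 3 + X 2 ^ 3 + X 3 ^ 3 + X 4 ^ 3))))
    (κ : AdjoinRoot g₀ →+* MvPolynomial (Fin 5) k)
    (hκ : κ.comp (AdjoinRoot.of g₀) = (aeval (fun i : Fin 5 => if i = 0 then (0 : MvPolynomial (Fin 5) k) else X i)).toRingHom ∧ κ (AdjoinRoot.root g₀) = 0)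
    (w : Spec (.of (AdjoinRoot g₀))) (hxw : AdjoinRoot.of g₀ (X 0) ∈ w.asIdeal) :
    ¬ FullCl 2 ((Spec (.of (AdjoinRoot g₀))).presheaf.stalk w) := by
  haveI : Fact (Nat.Prime 2) := ⟨Nat.prime_two⟩
  haveI h𝔭 : (RingHom.ker κ).IsPrime := RingHom.ker_isPrime κ
  intro hfw
  let η : Spec (.of (AdjoinRoot g₀)) := ⟨RingHom.ker κ, h𝔭⟩
  have hle : η.asIdeal ≤ w.asIdeal := by
    change RingHom.ker κ ≤ w.asIdeal
    rw [ker_killMap_eq k g₀ hg₀ κ hκ, Ideal.span_le]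
    rintro r hr
    rcases hr with rfl | rfl
    · exact hxw
    · exact root_mem_of_X0_mem k g₀ hg₀ w.asIdeal hxw
  have hηw : η ⤳ w := (PrimeSpectrum.le_iff_specializes _ _).mp ((PrimeSpectrum.asIdeal_le_asIdeal _ _).mp hle)
  haveI : CharP ((Spec (.of (AdjoinRoot g₀))).presheaf.stalk w) 2 :=
    FTemkinClosedPoints.charP_stalk_of_over 2 (Spec.map (CommRingCat.ofHom (algebraMap k (AdjoinRoot g₀)))) (𝟙 _) w
  have hη := ClauseLocalizes.fiClause_of_specializes 2 hηw hfw
  have hLη : FullCl 2 (Localization.AtPrime η.asIdeal) :=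
    WFixAtNonClosedDimTwo.fullCl_of_ringEquiv 2 (Spec.stalkIso (.of _) η).commRingCatIsoToRingEquiv hη
  exact not_fullCl_localization_kerKillMap k g₀ hg₀ κ hκ η.asIdeal rfl hLη

/-- ★★ Localization form: **every prime `P ∋ x̄` of `C_X` has a NON-FULL local ring `(C_X)_P`** [`CharP k 2`]. [OURS · certificate] -/
theorem not_fullCl_localization_of_mem [CharP k 2] (g₀ : Polynomial (MvPolynomial (Fin 5) k)) (hg₀ : g₀ = Polynomial.X ^ 2 + (Polynomial.C (X 0 ^ 2) * Polynomial.X + Polynomial.C (X 0 ^ 2 * (X 1 ^ 3 + X 2 ^ 3 + X 3 ^ 3 + X 4 ^ 3))))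
    (P : Ideal (AdjoinRoot g₀)) [hP : P.IsPrime] (hx : AdjoinRoot.of g₀ (X 0) ∈ P) : ¬ FullCl 2 (Localization.AtPrime P) := by
  obtain ⟨κ, hκ⟩ := exists_killMap k g₀ hg₀
  intro hfull
  let w : Spec (.of (AdjoinRoot g₀)) := ⟨P, hP⟩
  exact not_fullCl_stalk_of_mem k g₀ hg₀ κ hκ w hx (WFixAtNonClosedDimTwo.fullCl_of_ringEquiv 2 (Spec.stalkIso (.of _) w).commRingCatIsoToRingEquiv.symm hfull)

/-! ## §4 ★★ Every prime of `A₀[τ/x̄²]` over the vertex is NON-FULL -/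

set_option maxHeartbeats 800000 in
-- transport along the chart equivalence
/-- ★★ **Every prime `Q` of `A₀[τ/x̄²] = blowupAlgebra τ (x̄²)` with `𝔪_v ≤ Q ∩ A₀` has a NON-FULL local ring** [`CharP k 2`]: `Q` pulls back along
`C_X ≃+* blowupAlgebra τ (x̄²)` to a prime containing `x̄` (§3). [OURS · certificate; cite: Fedder1983, Prop. 1.7 (context)] -/
theorem not_fullCl_localization_blowupAlgebra_over [CharP k 2] (f : MvPolynomial (Fin 6) k) (hf : f = X 5 ^ 2 + X 0 ^ 4 * X 5 + X 1 ^ 3 + X 2 ^ 3 + X 3 ^ 3 + X 4 ^ 3)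
    (v : Spec (.of (MvPolynomial (Fin 6) k ⧸ Ideal.span {f})))
    (hv : v.asIdeal = Ideal.span (Set.range fun j : Fin 6 => Ideal.Quotient.mk (Ideal.span {f}) (X j)))
    (Q : Ideal (blowupAlgebra (Ideal.span {Ideal.Quotient.mk (Ideal.span {f}) (X 0) ^ 2, Ideal.Quotient.mk (Ideal.span {f}) (X 1), Ideal.Quotient.mk (Ideal.span {f}) (X 2), Ideal.Quotient.mk (Ideal.span {f}) (X 3), Ideal.Quotient.mk (Ideal.span {f}) (X 4), Ideal.Quotient.mk (Ideal.span {f}) (X 5)} :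
      Ideal (MvPolynomial (Fin 6) k ⧸ Ideal.span {f})) (Ideal.Quotient.mk (Ideal.span {f}) (X 0) ^ 2))) [Q.IsPrime]
    (hQv : v.asIdeal ≤ Q.comap (algebraMap (MvPolynomial (Fin 6) k ⧸ Ideal.span {f}) _)) :
    ¬ FullCl 2 (Localization.AtPrime Q) := by
  classical
  let g₀ : Polynomial (MvPolynomial (Fin 5) k) := Polynomial.X ^ 2 + (Polynomial.C (X 0 ^ 2) * Polynomial.X + Polynomial.C (X 0 ^ 2 * (X 1 ^ 3 + X 2 ^ 3 + X 3 ^ 3 + X 4 ^ 3)))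
  obtain ⟨e, -, heX, -⟩ := exists_chartEquiv k f hf g₀ rfl
  haveI : (Q.comap e.toRingHom).IsPrime := Ideal.IsPrime.comap _
  have hx : AdjoinRoot.of g₀ (X 0) ∈ Q.comap e.toRingHom := by
    rw [Ideal.mem_comap]
    have hval : e (AdjoinRoot.of g₀ (X 0)) = algebraMap (MvPolynomial (Fin 6) k ⧸ Ideal.span {f}) _ (Ideal.Quotient.mk (Ideal.span {f}) (X 0)) := by
      apply Subtype.ext
      rw [heX 0, Subalgebra.coe_algebraMap]
      rfl
    change e (AdjoinRoot.of g₀ (X 0)) ∈ Q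
    rw [hval]
    exact hQv (by rw [hv]; exact Ideal.subset_span ⟨0, rfl⟩)
  obtain ⟨eQ⟩ := E8Char5FiModel.nonempty_ringEquiv_localization_comap e Q
  exact fun hfull => not_fullCl_localization_of_mem k g₀ rfl (Q.comap e.toRingHom) hx (WFixAtNonClosedDimTwo.fullCl_of_ringEquiv 2 eQ.symm hfull)

end Summit.ResolutionOfSingularities.ResolutionOfSingularities.Theorems.FInjectiveMacaulayfication.TauFloorP2d5CXChartNotFull

end
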